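import Mathlib
import Literature.NumberTheory.LFunctions.WeilFirstPrimeOddMarginACheck
import Literature.NumberTheory.LFunctions.WeilFirstPrimeQuadratic
import Literature.NumberTheory.LFunctions.WeilFirstPrimePositivityC
import Summits.RiemannHypothesis.RiemannHypothesis.Theorems.WeilGroundStateGroundStateSimpleEvenOddMarginSound
import Summits.RiemannHypothesis.RiemannHypothesis.Theorems.WeilGroundStateGroundStateSimpleEvenStubLogAtoms
import HarnessLib

/-!
# Crux `GroundStateSimpleEven` (stmt-RiemannHypothesis-1526), line `parity-multiplicity-commutator` (v5):
# stub `stub_oddLowerA` — the certified odd-sector lower bound at `c = 2 / 5`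

Support file (`--supports stmt-RiemannHypothesis-1526`). Every `L²`-normalised ODD window-`c` test function
has `Re Q(g) ≥ κ − κ' = 3717716632904794440628028901250852967/340282366920938463463374607431768211456 ≈ 1.0925e-02`: the odd-sector margin certificate `weilCertOddA`
(`Literature/NumberTheory/LFunctions/WeilFirstPrimeOddMarginDataA.lean`, a₀ = 2/5; kernel-checked Booleans in
`…ACheck.lean`) fed to the odd-margin soundness theorem `stub_oddMarginSound`
(`…OddMarginSound.lean`: `(κ − κ')‖g‖₂² ≤ E₂(g)` for odd `g` on `[-a₀, a₀]`), and `E₂ = Re Q` on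
`C((log 3)/2)` (`weilQuadratic_re_eq_weilFirstPrimeQuadratic`).
-/

noncomputable section

open Set MeasureTheory
open Literature.NumberTheory.LFunctions

namespace Summit.RiemannHypothesis.RiemannHypothesis.Theorems.GroundStateSimpleEven

set_option linter.dupNamespace false in
/-- The odd-sector margin bound of certificate A: for every ODD test function `g` supported in
`[-(2 / 5), 2 / 5]`, `(κ − κ') ‖g‖₂² ≤ Re Q(g)` with `κ − κ' = 3717716632904794440628028901250852967/340282366920938463463374607431768211456`. [folklore] -/
theorem oddMarginA {g : ℝ → ℂ} (hg : IsWeilTest g)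
    (hsupp : tsupport g ⊆ Icc (-(2 / 5 : ℝ)) (2 / 5)) (hodd : ∀ x, g (-x) = -g x) :
    (3717716632904794440628028901250852967/340282366920938463463374607431768211456 : ℝ) * weilNorm2Sq g ≤ (weilQuadratic g).re := by
  have hb : tsupport g ⊆ Icc (-((weilCertOddA.b : ℚ) : ℝ)) ((weilCertOddA.b : ℚ) : ℝ) := by
    have e : ((weilCertOddA.b : ℚ) : ℝ) = 2 / 5 := by rw [show weilCertOddA.b = 2/5 from rfl]; push_cast; norm_num
    rw [e]; exact hsupp
  have h3 : tsupport g ⊆ Icc (-(Real.log 3 / 2)) (Real.log 3 / 2) :=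
    hsupp.trans (Icc_subset_Icc (by linarith [Summit.RiemannHypothesis.RiemannHypothesis.Theorems.stub_logAtoms.1]) (by linarith [Summit.RiemannHypothesis.RiemannHypothesis.Theorems.stub_logAtoms.1]))
  have hκ := kappa'_nonneg_le_weilCertOddA
  have h := Summit.RiemannHypothesis.RiemannHypothesis.Theorems.stub_oddMarginSound weilCertOddA weilCertOddAKappa'
    checkCells_weilCertOddA checkScalars_weilCertOddA checkNu_weilCertOddA checkBlock1_weilCertOddA hκ.1 hκ.2 g hg hb hodd
  rw [weilQuadratic_re_eq_weilFirstPrimeQuadratic hg h3]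
  have e2 : (((weilCertOddA.kappaQ - weilCertOddAKappa' : ℚ) : ℚ) : ℝ) = (3717716632904794440628028901250852967/340282366920938463463374607431768211456 : ℝ) := by
    rw [kappaQ_weilCertOddA]; unfold weilCertOddAKappa'; norm_num
  rw [e2] at h
  exact h

end Summit.RiemannHypothesis.RiemannHypothesis.Theorems.GroundStateSimpleEven

namespace Summit.RiemannHypothesis.RiemannHypothesis.Theorems

set_option linter.dupNamespace false in
/-- **Registered sub-goal (LA) of line `parity-multiplicity-commutator` (v5): the certified odd-sector
lower bound at `c = 2 / 5`** — every `L²`-normalised ODD window-`c` test function has `Re Q ≥ 1 / 100`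
(odd-sector margin certificate A, margin `κ − κ' ≈ 1.0925e-02`). [folklore] -/
theorem stub_oddLowerA :
    ∀ g : ℝ → ℂ, IsWeilTest g → tsupport g ⊆ Icc (-(2 / 5 : ℝ)) (2 / 5) →
      ∫ x, ‖g x‖ ^ 2 = (1 : ℝ) → (∀ x, g (-x) = -g x) → (1 / 100 : ℝ) ≤ (weilQuadratic g).re := by
  intro g hg hs hn ho
  have h := GroundStateSimpleEven.oddMarginA hg hs ho
  rw [show weilNorm2Sq g = 1 from hn, mul_one] at h
  refine le_trans (by norm_num) h

end Summit.RiemannHypothesis.RiemannHypothesis.Theorems
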